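import Mathlib

/-!
# Route LiouvilleSarnak — crux `LiouvilleCutRank` (stmt-ValiantsHypothesis-14775):
# ORBIT RIGIDITY — the saturation engine along the shift orbit of an ARBITRARY (aperiodic) cut word

`Theorems/LiouvilleSarnakLiouvilleCutRankPeriodicEngine.lean` is the engine behind every closed finely
interleaved family of the crux (`(CR)^n`, `(CCRR)^n`, the ratio criterion): ONE matrix `A` with a
self-similarity `A (ι x) (ι' y) = ± A x y` and finitely many rows has all rows invariant under some iterate
of `ι`.  A self-map exists only for PERIODIC cut words.  For an arbitrary infinite cut word `t` (the residual
class of the census: bounded-run aperiodic words, cf. `…Compactness.liouvilleCutRank_of_longRun_of_boundedRun`)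
the same arithmetic `λ(2^u m) = (-1)^u λ(m)` relates the matrix `A_s` of the shifted word `σ^s t` to the
matrix `A_{s+u}` of `σ^{s+u} t`: freezing the `u` lowest positions to `1` embeds `± A_{s+u}` into `A_s`.
This file proves, ABSTRACTLY (no arithmetic, no definitions), what finitely many rows force along such an
orbit:

* §1 `finite_rows_succ`, `ncard_rows_succ_le` — one embedding step `A s (ι x) (ι' y) = ε · A (s+1) x y`
  (`ε² = 1`) transports finiteness of the row set from `A s` to `A (s+1)` and the number of distinct rows is
  NON-INCREASING along the orbit.
* §2 `exists_rows_ncard_stable` — hence it is eventually CONSTANT: from some `s₀` on all `A s` have the same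
  (finite, positive) number of distinct rows.
* §3 ★ `rows_eq_embedded_rows`, `rows_eq_of_restrict_eq` — RIGIDITY at a stable index: if
  `A s (Φ x) (Ψ y) = ε · A s' x y` and `A s'` has at least as many distinct rows as `A s`, then EVERY row of
  `A s` is the row of some `Φ x` (for cut words: every row pattern is realised by a row index with all its
  `u` lowest row bits equal to `1`, for every `u`), and two rows of `A s` agreeing on the columns `Ψ y` agree
  everywhere.
* §4 ★★ `exists_forall_rows_embedded` — the two combined for a family of composite embeddings
  `A s (Φ s u x) (Ψ s u y) = ε s u · A (s+u) x y`: there is `s₀` such that for all `s ≥ s₀` and all `u`, every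
  row of `A s` is a `Φ s u`-row and rows are separated by the `Ψ s u`-columns.

This is the exact analogue of `PeriodicEngine.exists_iterate_rows_eq` / `rows_eq_of_restrict_eq` without
periodicity; a certificate (an entry identity contradicting one of the forced coincidences, e.g. from
`λ(3m) = -λ(m)`) is still needed word by word — see the census on the item.  Honest framing: an abstract
tool; `LiouvilleCutRank`, `DigitalBilinearLiouville`, `AlgebraicSarnak` stay OPEN; nothing here bears on
`VP ≠ VNP`.  No definitions.
-/

set_option linter.dupNamespace false

namespace Summit.ValiantsHypothesis.ValiantsHypothesis.Theorems.LiouvilleSarnakLiouvilleCutRank.OrbitRigidity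

/-! ### §1 One embedding step -/

/-- **Transport of rows along one embedding.**  If `A (Φ x) (Ψ y) = ε · B x y` with `ε · ε = 1`, then every
row of `B` is the restriction `y ↦ ε · f (Ψ y)` of a `Φ`-row `f` of `A`; so the row set of `B` is the image of
the set of `Φ`-rows of `A`. [folklore] -/
theorem range_eq_image_restrict {X Y X' Y' : Type*} (A : X → Y → ℤ) (B : X' → Y' → ℤ) (Φ : X' → X)
    (Ψ : Y' → Y) (ε : ℤ) (hε : ε * ε = 1) (hF : ∀ x y, A (Φ x) (Ψ y) = ε * B x y) :
    Set.range B = (fun f : Y → ℤ => fun y => ε * f (Ψ y)) '' Set.range (fun x => A (Φ x)) := by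
  ext g
  constructor
  · rintro ⟨x, rfl⟩
    refine ⟨A (Φ x), ⟨x, rfl⟩, ?_⟩
    funext y
    show ε * A (Φ x) (Ψ y) = B x y
    rw [hF, ← mul_assoc, hε, one_mul]
  · rintro ⟨f, ⟨x, rfl⟩, rfl⟩
    refine ⟨x, ?_⟩
    funext y
    show B x y = ε * A (Φ x) (Ψ y)
    rw [hF, ← mul_assoc, hε, one_mul]

/-- **Finiteness and monotonicity along one step.**  If `A (Φ x) (Ψ y) = ε · B x y` (`ε · ε = 1`) and `A` has
finitely many distinct rows, then so does `B`, and `B` has at most as many distinct rows as `A` has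
`Φ`-rows, hence at most as many as `A`. [folklore] -/
theorem finite_and_ncard_le_of_embedding {X Y X' Y' : Type*} (A : X → Y → ℤ) (B : X' → Y' → ℤ)
    (Φ : X' → X) (Ψ : Y' → Y) (ε : ℤ) (hε : ε * ε = 1) (hF : ∀ x y, A (Φ x) (Ψ y) = ε * B x y)
    (hfin : (Set.range A).Finite) :
    (Set.range B).Finite ∧
      (Set.range B).ncard ≤ (Set.range (fun x => A (Φ x))).ncard ∧
      (Set.range (fun x => A (Φ x))).ncard ≤ (Set.range A).ncard := by
  have hsub : Set.range (fun x => A (Φ x)) ⊆ Set.range A := by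
    rintro _ ⟨x, rfl⟩; exact ⟨Φ x, rfl⟩
  have hfinΦ : (Set.range (fun x => A (Φ x))).Finite := hfin.subset hsub
  rw [range_eq_image_restrict A B Φ Ψ ε hε hF]
  exact ⟨hfinΦ.image _, Set.ncard_image_le hfinΦ, Set.ncard_le_ncard hsub hfin⟩

/-- One orbit step: finiteness of the row set passes from `A s` to `A (s+1)`. [folklore] -/
theorem finite_rows_succ {X Y : Type*} (A : ℕ → X → Y → ℤ) (ι : ℕ → X → X) (ι' : ℕ → Y → Y)
    (ε : ℕ → ℤ) (hε : ∀ s, ε s * ε s = 1) (hF : ∀ s x y, A s (ι s x) (ι' s y) = ε s * A (s + 1) x y)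
    (hfin : (Set.range (A 0)).Finite) : ∀ s, (Set.range (A s)).Finite := by
  intro s
  induction s with
  | zero => exact hfin
  | succ s ih =>
    exact (finite_and_ncard_le_of_embedding (A s) (A (s + 1)) (ι s) (ι' s) (ε s) (hε s) (hF s) ih).1

/-- One orbit step: the number of distinct rows does not increase from `A s` to `A (s+1)`. [folklore] -/
theorem ncard_rows_succ_le {X Y : Type*} (A : ℕ → X → Y → ℤ) (ι : ℕ → X → X) (ι' : ℕ → Y → Y)
    (ε : ℕ → ℤ) (hε : ∀ s, ε s * ε s = 1) (hF : ∀ s x y, A s (ι s x) (ι' s y) = ε s * A (s + 1) x y)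
    (hfin : (Set.range (A 0)).Finite) (s : ℕ) :
    (Set.range (A (s + 1))).ncard ≤ (Set.range (A s)).ncard := by
  have h := finite_and_ncard_le_of_embedding (A s) (A (s + 1)) (ι s) (ι' s) (ε s) (hε s) (hF s)
    (finite_rows_succ A ι ι' ε hε hF hfin s)
  exact h.2.1.trans h.2.2

/-! ### §2 Stabilisation -/

/-- **Eventually constant row count.**  Along an orbit of embeddings with finitely many rows at the start,
the number of distinct rows is eventually constant (and positive when `Y`-rows exist, i.e. `X` nonempty):
there is `s₀` with `#rows(A s) = #rows(A s₀)` for all `s ≥ s₀`. [folklore] -/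
theorem exists_rows_ncard_stable {X Y : Type*} (A : ℕ → X → Y → ℤ) (ι : ℕ → X → X) (ι' : ℕ → Y → Y)
    (ε : ℕ → ℤ) (hε : ∀ s, ε s * ε s = 1) (hF : ∀ s x y, A s (ι s x) (ι' s y) = ε s * A (s + 1) x y)
    (hfin : (Set.range (A 0)).Finite) :
    ∃ s₀ : ℕ, ∀ s, s₀ ≤ s → (Set.range (A s)).ncard = (Set.range (A s₀)).ncard := by
  classical
  set c : ℕ → ℕ := fun s => (Set.range (A s)).ncard with hc
  have hanti : ∀ s u, c (s + u) ≤ c s := by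
    intro s u
    induction u with
    | zero => exact le_rfl
    | succ u ih =>
      exact (ncard_rows_succ_le A ι ι' ε hε hF hfin (s + u)).trans ih
  -- the minimum value of `c` is attained at some `s₀`; from there on `c` is constant
  have hne : (Set.range c).Nonempty := ⟨c 0, 0, rfl⟩
  obtain ⟨s₀, hs₀⟩ : ∃ s₀, c s₀ = sInf (Set.range c) := by
    obtain ⟨s₀, h⟩ := Nat.sInf_mem hne
    exact ⟨s₀, h⟩
  refine ⟨s₀, fun s hs => le_antisymm ?_ ?_⟩
  · obtain ⟨u, rfl⟩ := Nat.exists_eq_add_of_le hs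
    exact hanti s₀ u
  · show c s₀ ≤ c s
    rw [hs₀]
    exact Nat.sInf_le ⟨s, rfl⟩

/-! ### §3 Rigidity at a stable index -/

/-- ★ **Every row is an embedded row.**  If `A (Φ x) (Ψ y) = ε · B x y` (`ε · ε = 1`), `A` has finitely many
distinct rows and `B` has AT LEAST as many distinct rows as `A`, then every row of `A` is the row of some
`Φ x`.  (The `Φ`-rows of `A` surject onto the rows of `B` by restriction, so
`#rows B ≤ #Φ-rows A ≤ #rows A ≤ #rows B`.) [this file] -/
theorem rows_eq_embedded_rows {X Y X' Y' : Type*} (A : X → Y → ℤ) (B : X' → Y' → ℤ) (Φ : X' → X)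
    (Ψ : Y' → Y) (ε : ℤ) (hε : ε * ε = 1) (hF : ∀ x y, A (Φ x) (Ψ y) = ε * B x y)
    (hfin : (Set.range A).Finite) (hcard : (Set.range A).ncard ≤ (Set.range B).ncard) :
    ∀ z : X, ∃ x : X', A z = A (Φ x) := by
  have h := finite_and_ncard_le_of_embedding A B Φ Ψ ε hε hF hfin
  have hsub : Set.range (fun x => A (Φ x)) ⊆ Set.range A := by
    rintro _ ⟨x, rfl⟩; exact ⟨Φ x, rfl⟩
  have hEq : Set.range (fun x => A (Φ x)) = Set.range A :=
    Set.eq_of_subset_of_ncard_le hsub (hcard.trans h.2.1) hfin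
  intro z
  have hz : A z ∈ Set.range (fun x => A (Φ x)) := by rw [hEq]; exact ⟨z, rfl⟩
  obtain ⟨x, hx⟩ := hz
  exact ⟨x, hx.symm⟩

/-- ★ **Rows are separated by the embedded columns.**  Under the same hypotheses, two rows of `A` that agree
at every column `Ψ y` are equal.  (Restriction is a surjection from the finite row set of `A` onto the row
set of `B`, which is at least as large — hence injective.) [this file] -/
theorem rows_eq_of_restrict_eq {X Y X' Y' : Type*} (A : X → Y → ℤ) (B : X' → Y' → ℤ) (Φ : X' → X)
    (Ψ : Y' → Y) (ε : ℤ) (hε : ε * ε = 1) (hF : ∀ x y, A (Φ x) (Ψ y) = ε * B x y)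
    (hfin : (Set.range A).Finite) (hcard : (Set.range A).ncard ≤ (Set.range B).ncard)
    (x x' : X) (h : ∀ y, A x (Ψ y) = A x' (Ψ y)) : A x = A x' := by
  classical
  set res : (Y → ℤ) → (Y' → ℤ) := fun f => fun y => ε * f (Ψ y) with hres
  have hfe := finite_and_ncard_le_of_embedding A B Φ Ψ ε hε hF hfin
  have hsub : Set.range (fun x => A (Φ x)) ⊆ Set.range A := by
    rintro _ ⟨x, rfl⟩; exact ⟨Φ x, rfl⟩
  have hB : Set.range B = res '' Set.range (fun x => A (Φ x)) :=
    range_eq_image_restrict A B Φ Ψ ε hε hF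
  -- `res` is injective on the row set of `A`
  have himage_le : (res '' Set.range A).ncard ≤ (Set.range A).ncard := Set.ncard_image_le hfin
  have himage_ge : (Set.range A).ncard ≤ (res '' Set.range A).ncard := by
    calc (Set.range A).ncard ≤ (Set.range B).ncard := hcard
      _ = (res '' Set.range (fun x => A (Φ x))).ncard := by rw [hB]
      _ ≤ (res '' Set.range A).ncard :=
          Set.ncard_le_ncard (Set.image_mono hsub) (hfin.image _)
  have hinj : Set.InjOn res (Set.range A) :=
    (Set.ncard_image_iff hfin).mp (le_antisymm himage_le himage_ge)
  refine hinj ⟨x, rfl⟩ ⟨x', rfl⟩ ?_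
  funext y
  show ε * A x (Ψ y) = ε * A x' (Ψ y)
  rw [h y]

/-! ### §4 The orbit form -/

/-- ★★ **Orbit rigidity.**  Let `A s` (`s ∈ ℕ`) be matrices linked by one-step embeddings
`A s (ι s x) (ι' s y) = ε s · A (s+1) x y` and by composite embeddings
`A s (Φ s u x) (Ψ s u y) = η s u · A (s+u) x y` (all signs square to `1`), and let `A 0` have finitely many
distinct rows.  Then there is `s₀` such that for every `s ≥ s₀` and every `u`:
every row of `A s` is the row of some `Φ s u x`, and two rows of `A s` agreeing on all columns `Ψ s u y`
are equal.  (For the cut matrices of the shifts of an infinite cut word, `Φ s u` / `Ψ s u` = "set the `u`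
lowest row / column positions to `1` and shift", `η s u = (-1)^u`.) [this file] -/
theorem exists_forall_rows_embedded {X Y : Type*} (A : ℕ → X → Y → ℤ) (ι : ℕ → X → X)
    (ι' : ℕ → Y → Y) (ε : ℕ → ℤ) (hε : ∀ s, ε s * ε s = 1)
    (hF : ∀ s x y, A s (ι s x) (ι' s y) = ε s * A (s + 1) x y)
    (Φ : ℕ → ℕ → X → X) (Ψ : ℕ → ℕ → Y → Y) (η : ℕ → ℕ → ℤ) (hη : ∀ s u, η s u * η s u = 1)
    (hΦ : ∀ s u x y, A s (Φ s u x) (Ψ s u y) = η s u * A (s + u) x y)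
    (hfin : (Set.range (A 0)).Finite) :
    ∃ s₀ : ℕ, ∀ s, s₀ ≤ s → ∀ u : ℕ,
      (∀ z : X, ∃ x : X, A s z = A s (Φ s u x)) ∧
      (∀ x x' : X, (∀ y, A s x (Ψ s u y) = A s x' (Ψ s u y)) → A s x = A s x') := by
  obtain ⟨s₀, hs₀⟩ := exists_rows_ncard_stable A ι ι' ε hε hF hfin
  have hfinall := finite_rows_succ A ι ι' ε hε hF hfin
  refine ⟨s₀, fun s hs u => ?_⟩
  have hcard : (Set.range (A s)).ncard ≤ (Set.range (A (s + u))).ncard := by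
    rw [hs₀ s hs, hs₀ (s + u) (by omega)]
  exact ⟨rows_eq_embedded_rows (A s) (A (s + u)) (Φ s u) (Ψ s u) (η s u) (hη s u) (hΦ s u)
      (hfinall s) hcard,
    fun x x' h => rows_eq_of_restrict_eq (A s) (A (s + u)) (Φ s u) (Ψ s u) (η s u) (hη s u) (hΦ s u)
      (hfinall s) hcard x x' h⟩

end Summit.ValiantsHypothesis.ValiantsHypothesis.Theorems.LiouvilleSarnakLiouvilleCutRank.OrbitRigidity
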